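/-
Origin: expansion seat `planner-pub-hodgecm-prl1-g3-0`, handover #3 2026-08-18T05:55:15Z (`HOME/pub-hodgecm-prl1-g3/lean/Prl1g3/DiscreteDecomposition.lean`, md5 113c64fd, 366 lines);
landed by the gen-6 packager in gate run 24 as `HodgeCM/Automorphic/DiscreteDecomposition.lean` (import ^import Prl1g3\.→import HodgeCM.Automorphic. ×1).
-/
/-
Origin: HOME/pub-hodgecm-prl1-g3/lean/Prl1g3/DiscreteDecomposition.lean — session planner-pub-hodgecm-prl1-g3-0
(unit pub-hodgecm-prl1-g3, EXPANSION PROVER a-1 gen 3: CONSTRUCT the realisation).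
Intended final place (packager's call): `HodgeCM/Automorphic/DiscreteDecomposition.lean`; module renames
`Prl1g3.IsotypicDecomposition` ↦ `HodgeCM.Automorphic.IsotypicDecomposition`, `Prl1g3.ThetaCarrierRep` ↦
`HodgeCM.Automorphic.ThetaCarrierRep` (both mine, handed over before this file).  NEW, ADDITIVE; touches no existing file.

KIND: KERNEL (the discreteness theorem) + L2 (a finer hypothesis record).  The ONE hypothesis field with a citation of
PUBLISHED theorems (verbatim, with pages) is `RepCoreCarrier.AnalyticK.compactApprox` — see its docstring.  Nothing is
posited.
-/
import Summits.HodgeConjecture.HodgeCM.Automorphic.ThetaCarrierRep_2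
import Mathlib.Analysis.InnerProductSpace.Spectrum

set_option autoImplicit false

/-!
# Discrete decomposition of a unitary representation from compact operators — PROVED

The one remaining PRINT hypothesis of the core carrier about `L²([U(W)])` (`RepCoreCarrier.Analytic.discreteDecomp`:
"`H` is the closed span of its irreducible closed `R`-invariant subspaces", PerL v5 ll. 384–385, the CONCLUSION of
Gelfand–Graev–Piatetski-Shapiro's theorem) is here DERIVED, inside the kernel, from its published INPUT: the
existence of enough COMPACT operators.

* `RepDecomp.HasCompactApprox R` : there is a set `𝒦` of bounded operators on `H`, each COMPACT, SYMMETRIC and mapping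
  every closed `R`-invariant subspace into itself, and jointly non-degenerate (`∀ v ≠ 0, ∃ K ∈ 𝒦, K v ≠ 0`).
  In the intended model `𝒦 = {R(f)^* R(f) | f ∈ C_c^∞(U(W)(𝔸))}`: compact because `R(f)` is (Hilbert–Schmidt on the
  compact quotient), preserving closed invariant subspaces because `R(f) = ∫ f(g) R(g) dg` and `R(f)^* = R(f^*)` do,
  non-degenerate because `R(f_n) v → v` along a Dirac sequence.
* `RepDecomp.exists_irreducible_le_of_compact` (KERNEL; the argument of [Borel, *Automorphic forms on SL₂(ℝ)*,
  Lemma 16.1] = [Getz–Hahn, GTM 300, Lemma 9.3.1]): a closed invariant subspace on which some such `K` is non-zero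
  contains an irreducible closed invariant subspace — `K|_W` has a non-zero eigenvalue (Mathlib's spectral theorem for
  compact self-adjoint operators, `ContinuousLinearMap.eq_zero_of_forall_hasEigenvalue_eq_zero`), its eigenspace is
  finite-dimensional (`ContinuousLinearMap.finite_dimensional_eigenspace`), a closed invariant `W₀ ≤ W` minimising
  `dim (W₀ ∩ E_μ) > 0` exists, and the closed cyclic subspace of a vector of `W₀ ∩ E_μ` is irreducible.
* `RepDecomp.discreteDecomp_of_compactApprox` (KERNEL): `HasCompactApprox R →` discrete decomposition: the orthogonal
  complement of the closed span of the irreducibles is closed, invariant and contains no irreducible, hence is `⊥`.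
* `RepCoreCarrier.AnalyticK` = `{R_unitary, compactApprox, hatτ_complete}` and `AnalyticK.toAnalytic`; the universe
  level `Universe.RepThetaCarrier.AnalyticK`, `AnalyticK.toAnalytic`, and the END STATE over it
  (`Assembly.realisationExists_ofRepCarrierK`, `Assembly.COR_CM_endState_ofRepCarrierK`).
-/

noncomputable section

open scoped InnerProductSpace ComplexConjugate

namespace HodgeCM
namespace RepDecomp

open HodgeCM.PerL34 HodgeCM.PerL34.Spectral

variable {H : Type*} [NormedAddCommGroup H] [InnerProductSpace ℂ H] [CompleteSpace H]
variable {G : Type*} [Group G]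
variable {R : G →* (H →L[ℂ] H)}

/-! ## 1. Tools: suprema of invariant subspaces, closed cyclic subspaces -/

omit [CompleteSpace H] in
/-- (Ported verbatim from the HodgeCMPerL package; no docstring in the source.) -/
theorem Invariant.iSup {ι : Sort*} {V : ι → Submodule ℂ H} (h : ∀ i, Invariant R (V i)) :
    Invariant R (⨆ i, V i) := by
  intro g v hv
  refine Submodule.iSup_induction _ (motive := fun v => R g v ∈ ⨆ i, V i) hv ?_ ?_ ?_
  · intro i v hv
    exact Submodule.mem_iSup_of_mem i (h i g v hv)
  · rw [map_zero]
    exact zero_mem _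
  · intro x y hx hy
    rw [map_add]
    exact add_mem hx hy

variable (R) in
/-- The closed cyclic subspace generated by a vector: the closure of the span of its orbit. -/
def cyclic (e : H) : Submodule ℂ H :=
  (Submodule.span ℂ (Set.range fun g : G => R g e)).topologicalClosure

omit [CompleteSpace H] in
/-- (Ported verbatim from the HodgeCMPerL package; no docstring in the source.) -/
theorem mem_cyclic_self (e : H) : e ∈ cyclic R e :=
  Submodule.le_topologicalClosure _ (Submodule.subset_span ⟨1, by simp only [map_one]; rfl⟩)

omit [CompleteSpace H] in
/-- (Ported verbatim from the HodgeCMPerL package; no docstring in the source.) -/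
theorem isClosed_cyclic (e : H) : IsClosed (cyclic R e : Set H) :=
  Submodule.isClosed_topologicalClosure _

omit [CompleteSpace H] in
/-- (Ported verbatim from the HodgeCMPerL package; no docstring in the source.) -/
theorem cyclic_invariant (e : H) : Invariant R (cyclic R e) := by
  apply Invariant.topologicalClosure
  intro g v hv
  have hle : (Submodule.span ℂ (Set.range fun g : G => R g e)).map (R g).toLinearMap ≤
      Submodule.span ℂ (Set.range fun g : G => R g e) := by
    rw [Submodule.map_span_le]
    rintro _ ⟨h, rfl⟩
    exact Submodule.subset_span ⟨g * h, mul_apply' R g h e⟩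
  exact hle ⟨v, hv, rfl⟩

omit [CompleteSpace H] in
/-- A closed invariant subspace containing `e` contains its closed cyclic subspace. -/
theorem cyclic_le {e : H} {A : Submodule ℂ H} (hAc : IsClosed (A : Set H)) (hA : Invariant R A) (he : e ∈ A) :
    cyclic R e ≤ A := by
  refine Submodule.topologicalClosure_minimal _ ?_ hAc
  rw [Submodule.span_le]
  rintro _ ⟨g, rfl⟩
  exact hA g e he

/-! ## 2. The key lemma: a compact symmetric operator produces an irreducible -/

/-- **KEY LEMMA** ([Borel 1997, Lemma 16.1]; [Getz–Hahn 2024, Lemma 9.3.1]) — PROVED.  Let `K` be a compact symmetric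
operator mapping every closed `R`-invariant subspace into itself, and `W` a closed `R`-invariant subspace on which
`K` is not zero.  Then `W` contains an irreducible closed `R`-invariant subspace. -/
theorem exists_irreducible_le_of_compact (hR : IsUnitaryRep R) {K : H →L[ℂ] H} (hKc : IsCompactOperator K)
    (hKs : (K : H →ₗ[ℂ] H).IsSymmetric)
    (hKinv : ∀ M : Submodule ℂ H, IsClosed (M : Set H) → Invariant R M → ∀ v ∈ M, K v ∈ M)
    {W : Submodule ℂ H} (hWc : IsClosed (W : Set H)) (hW : Invariant R W) (hKW : ∃ w ∈ W, K w ≠ 0) :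
    ∃ V, IsIrreducible R V ∧ V ≤ W := by
  classical
  haveI : CompleteSpace W := hWc.completeSpace_coe
  have hKW' : ∀ v ∈ W, K v ∈ W := hKinv W hWc hW
  -- Step 1: a non-zero eigenvalue of `K` with an eigenvector in `W`
  obtain ⟨μ, hμ0, w, hwW, hw0, hKw⟩ : ∃ μ : ℂ, μ ≠ 0 ∧ ∃ w ∈ W, w ≠ 0 ∧ K w = μ • w := by
    set KW : W →L[ℂ] W := K.restrict hKW' with hKWdef
    have hc : IsCompactOperator KW := hKc.restrict hKW' hWc
    have hs : (KW : W →ₗ[ℂ] W).IsSymmetric := hKs.restrict_invariant hKW'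
    have hne : KW ≠ 0 := by
      obtain ⟨w, hw, hKw⟩ := hKW
      intro h0
      apply hKw
      have h1 : ((KW ⟨w, hw⟩ : W) : H) = K w := rfl
      rw [← h1, h0]
      rfl
    have h := mt (ContinuousLinearMap.eq_zero_of_forall_hasEigenvalue_eq_zero hc hs).mp hne
    push Not at h
    obtain ⟨μ, hμ, hμ0⟩ := h
    obtain ⟨x, hx⟩ := hμ.exists_hasEigenvector
    have h1 : (KW : Module.End ℂ W) x = μ • x := Module.End.mem_eigenspace_iff.mp hx.1
    refine ⟨μ, hμ0, x, x.2, fun h0 => hx.2 (Subtype.ext h0), ?_⟩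
    have h2 := congrArg (fun y : W => (y : H)) h1
    simpa [hKWdef] using h2
  -- Step 2: the finite-dimensional slice `EH = W ∩ E_μ(K)` and a closed invariant `W₀ ≤ W` minimising `dim (W₀ ∩ EH) > 0`
  set EH : Submodule ℂ H := W ⊓ Module.End.eigenspace (K : H →ₗ[ℂ] H) μ with hEHdef
  have hmemEH : ∀ v, v ∈ EH ↔ v ∈ W ∧ K v = μ • v := fun v => by
    simp only [hEHdef, Submodule.mem_inf, Module.End.mem_eigenspace_iff, ContinuousLinearMap.coe_coe]
  haveI hfinE : FiniteDimensional ℂ (Module.End.eigenspace (K : H →ₗ[ℂ] H) μ) :=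
    ContinuousLinearMap.finite_dimensional_eigenspace hKc μ hμ0
  haveI hfin : FiniteDimensional ℂ EH := Submodule.finiteDimensional_of_le inf_le_right
  let Adm : Submodule ℂ H → Prop := fun W' =>
    IsClosed (W' : Set H) ∧ Invariant R W' ∧ W' ≤ W ∧ W' ⊓ EH ≠ ⊥
  have hWadm : Adm W := by
    refine ⟨hWc, hW, le_rfl, ?_⟩
    rw [Submodule.ne_bot_iff]
    exact ⟨w, ⟨hwW, (hmemEH w).mpr ⟨hwW, hKw⟩⟩, hw0⟩
  let P : ℕ → Prop := fun n => ∃ W', Adm W' ∧ Module.finrank ℂ ↥(W' ⊓ EH) = n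
  have hP : ∃ n, P n := ⟨_, W, hWadm, rfl⟩
  obtain ⟨W₀, ⟨hW₀c, hW₀inv, hW₀le, hW₀ne⟩, hW₀d⟩ := Nat.find_spec hP
  have hmin : ∀ W', Adm W' → Module.finrank ℂ ↥(W₀ ⊓ EH) ≤ Module.finrank ℂ ↥(W' ⊓ EH) := by
    intro W' hW'
    rw [hW₀d]
    exact Nat.find_min' hP ⟨W', hW', rfl⟩
  obtain ⟨e, he, he0⟩ := Submodule.exists_mem_ne_zero_of_ne_bot hW₀ne
  have hcycW₀ : cyclic R e ≤ W₀ := cyclic_le hW₀c hW₀inv he.1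
  -- Step 3: the closed cyclic subspace of `e` is irreducible
  refine ⟨cyclic R e, ⟨isClosed_cyclic e, cyclic_invariant e, ?_, ?_⟩, hcycW₀.trans hW₀le⟩
  · exact (Submodule.ne_bot_iff _).mpr ⟨e, mem_cyclic_self e, he0⟩
  · intro A hAle hAc hAinv
    haveI : CompleteSpace A := hAc.completeSpace_coe
    set a := A.starProjection e with hadef
    set b := e - a with hbdef
    have haA : a ∈ A := A.starProjection_apply_mem e
    have hbAo : b ∈ Aᗮ := A.sub_starProjection_mem_orthogonal e
    have hB : Invariant R (cyclic R e ⊓ Aᗮ) := (cyclic_invariant e).inf (hAinv.orthogonal hR)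
    have hBc : IsClosed ((cyclic R e ⊓ Aᗮ : Submodule ℂ H) : Set H) := by
      rw [Submodule.coe_inf]
      exact (isClosed_cyclic e).inter (Submodule.isClosed_orthogonal A)
    have hbB : b ∈ cyclic R e ⊓ Aᗮ := ⟨sub_mem (mem_cyclic_self e) (hAle haA), hbAo⟩
    have hKe : K e = μ • e := ((hmemEH e).mp he.2).2
    have hKa : K a ∈ A := hKinv A hAc hAinv a haA
    have hKb : K b ∈ Aᗮ := (hKinv _ hBc hB b hbB).2
    have hab : a + b = e := by rw [hbdef]; abel
    have hsum : (K a - μ • a) + (K b - μ • b) = 0 := by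
      have h1 : K a + K b = μ • a + μ • b := by rw [← map_add, ← smul_add, hab, hKe]
      rw [show K a - μ • a + (K b - μ • b) = (K a + K b) - (μ • a + μ • b) by abel, h1, sub_self]
    have hx : K a - μ • a ∈ A := sub_mem hKa (A.smul_mem μ haA)
    have hy : K b - μ • b ∈ Aᗮ := sub_mem hKb (Aᗮ.smul_mem μ hbAo)
    have hxo : K a - μ • a ∈ Aᗮ := by
      rw [eq_neg_of_add_eq_zero_left hsum]
      exact neg_mem hy
    have hKa' : K a = μ • a := by
      have h0 : K a - μ • a ∈ A ⊓ Aᗮ := ⟨hx, hxo⟩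
      rw [Submodule.inf_orthogonal_eq_bot, Submodule.mem_bot] at h0
      exact sub_eq_zero.mp h0
    by_cases ha0 : a = 0
    · -- `e = b ⟂ A`, so the cyclic subspace is `⟂ A` and `A ≤ A ∩ Aᗮ = ⊥`
      left
      have hbe : b = e := by rw [hbdef, ha0, sub_zero]
      have heB : e ∈ cyclic R e ⊓ Aᗮ := ⟨mem_cyclic_self e, hbe ▸ hbAo⟩
      have hle : cyclic R e ≤ Aᗮ := (cyclic_le hBc hB heB).trans inf_le_right
      rw [eq_bot_iff]
      intro x hx'
      have hxx : x ∈ A ⊓ Aᗮ := ⟨hx', hle (hAle hx')⟩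
      rwa [Submodule.inf_orthogonal_eq_bot] at hxx
    · -- `a ≠ 0`: `A` is admissible, so by minimality `A ∩ EH = W₀ ∩ EH ∋ e`, hence `e ∈ A` and `A = cyclic e`
      right
      have hAW₀ : A ≤ W₀ := hAle.trans hcycW₀
      have haEH : a ∈ EH := (hmemEH a).mpr ⟨hW₀le (hAW₀ haA), hKa'⟩
      have hAadm : Adm A := by
        refine ⟨hAc, hAinv, hAW₀.trans hW₀le, ?_⟩
        rw [Submodule.ne_bot_iff]
        exact ⟨a, ⟨haA, haEH⟩, ha0⟩
      have hle2 : A ⊓ EH ≤ W₀ ⊓ EH := inf_le_inf_right EH hAW₀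
      haveI : FiniteDimensional ℂ ↥(W₀ ⊓ EH) := Submodule.finiteDimensional_of_le inf_le_right
      have heq : A ⊓ EH = W₀ ⊓ EH :=
        Submodule.eq_of_le_of_finrank_eq hle2 (le_antisymm (Submodule.finrank_mono hle2) (hmin A hAadm))
      have heA : e ∈ A := by
        have heAE : e ∈ A ⊓ EH := by
          rw [heq]
          exact he
        exact heAE.1
      exact le_antisymm hAle (cyclic_le hAc hAinv heA)

/-- Corollary: every non-zero closed invariant subspace contains an irreducible one, given a compact approximation. -/
theorem exists_irreducible_le (hR : IsUnitaryRep R) {𝒦 : Set (H →L[ℂ] H)}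
    (h𝒦 : ∀ K ∈ 𝒦, IsCompactOperator K ∧ (K : H →ₗ[ℂ] H).IsSymmetric ∧
      ∀ M : Submodule ℂ H, IsClosed (M : Set H) → Invariant R M → ∀ v ∈ M, K v ∈ M)
    (hnd : ∀ v : H, v ≠ 0 → ∃ K ∈ 𝒦, K v ≠ 0)
    {W : Submodule ℂ H} (hWc : IsClosed (W : Set H)) (hW : Invariant R W) (hW0 : W ≠ ⊥) :
    ∃ V, IsIrreducible R V ∧ V ≤ W := by
  obtain ⟨w, hw, hw0⟩ := Submodule.exists_mem_ne_zero_of_ne_bot hW0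
  obtain ⟨K, hK, hKw⟩ := hnd w hw0
  obtain ⟨hKc, hKs, hKinv⟩ := h𝒦 K hK
  exact exists_irreducible_le_of_compact hR hKc hKs hKinv hWc hW ⟨w, hw, hKw⟩

/-! ## 3. Discrete decomposition -/

variable (R) in
/-- **A compact approximation of `R`** (the published INPUT of the discreteness of the spectrum): a set `𝒦` of bounded
operators, each COMPACT, SYMMETRIC and mapping every closed `R`-invariant subspace into itself, such that every
non-zero vector is moved by some `K ∈ 𝒦`.  Intended model: `𝒦 = {R(f)^* R(f) | f ∈ C_c^∞(U(W)(𝔸))}`. -/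
def HasCompactApprox : Prop :=
  ∃ 𝒦 : Set (H →L[ℂ] H),
    (∀ K ∈ 𝒦, IsCompactOperator K ∧ (K : H →ₗ[ℂ] H).IsSymmetric ∧
      ∀ M : Submodule ℂ H, IsClosed (M : Set H) → Invariant R M → ∀ v ∈ M, K v ∈ M) ∧
    ∀ v : H, v ≠ 0 → ∃ K ∈ 𝒦, K v ≠ 0

/-- **DISCRETE DECOMPOSITION — PROVED from a compact approximation** (Gelfand–Graev–Piatetski-Shapiro; [Getz–Hahn
2024, Cor. 9.1.2 ⇐ Thm 9.1.1]): `H` is the closed span of its irreducible closed `R`-invariant subspaces. -/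
theorem discreteDecomp_of_compactApprox (hR : IsUnitaryRep R) (h : HasCompactApprox R) :
    (⨆ V : Irr R, (V.1 : Submodule ℂ H)).topologicalClosure = ⊤ := by
  obtain ⟨𝒦, h𝒦, hnd⟩ := h
  set S := (⨆ V : Irr R, (V.1 : Submodule ℂ H)).topologicalClosure with hSdef
  have hSinv : Invariant R S := (Invariant.iSup fun V : Irr R => V.2.invariant).topologicalClosure
  have hSo : Invariant R Sᗮ := hSinv.orthogonal hR
  have hSoc : IsClosed ((Sᗮ : Submodule ℂ H) : Set H) := Submodule.isClosed_orthogonal _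
  rw [← Submodule.orthogonal_eq_bot_iff]
  by_contra hne
  obtain ⟨V, hV, hVle⟩ := exists_irreducible_le hR h𝒦 hnd hSoc hSo hne
  have hVS : V ≤ S :=
    (le_iSup (fun W : Irr R => (W.1 : Submodule ℂ H)) ⟨V, hV⟩).trans (Submodule.le_topologicalClosure _)
  apply hV.ne_bot
  rw [eq_bot_iff]
  intro x hx
  have hxx : x ∈ S ⊓ Sᗮ := ⟨hVS hx, hVle hx⟩
  rwa [Submodule.inf_orthogonal_eq_bot] at hxx

/-- The same conclusion in the `hatσ_complete` form of the carrier (components indexed by classes). -/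
theorem iSup_isotypic_complete_of_compactApprox (hR : IsUnitaryRep R) (h : HasCompactApprox R) :
    (⨆ c, isotypic R c).topologicalClosure = ⊤ := by
  rw [iSup_isotypic_eq]
  exact discreteDecomp_of_compactApprox hR h

end RepDecomp

/-! ## 4. The finer hypothesis record of the core and the end state over it -/

namespace RepCoreCarrier

variable {H HG CG G SK SigIdxG : Type}
variable [NormedAddCommGroup H] [InnerProductSpace ℂ H] [CompleteSpace H]
variable [NormedAddCommGroup HG] [InnerProductSpace ℂ HG] [CompleteSpace HG]
variable [NormedAddCommGroup CG] [NormedSpace ℂ CG]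
variable [Group G] [TopologicalSpace G] [TopologicalSpace SK]
variable (C : RepCoreCarrier H HG CG G SK SigIdxG)

/-- **The core axioms with the discreteness INPUT in place of its conclusion**: `discreteDecomp` is replaced by
`compactApprox` (from which it follows in the kernel, `AnalyticK.toAnalytic`). -/
structure AnalyticK : Prop where
  /-- AX9 (l. 382–383): `R` is unitary. -/
  R_unitary : ∀ (g : G) (u v : H), ⟪C.R g u, C.R g v⟫_ℂ = ⟪u, v⟫_ℂ
  /-- **Compact approximation of `R`** (`RepDecomp.HasCompactApprox C.R`): there is a set `𝒦` of COMPACT SYMMETRIC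
  operators on `L²([U(W)])`, each mapping every closed `R(U(W)(𝔸))`-invariant subspace into itself, jointly moving
  every non-zero vector.  This is the published INPUT of the discrete decomposition (PerL v5 ll. 384–385), which is
  now DERIVED from it (`AnalyticK.toAnalytic`, via `RepDecomp.discreteDecomp_of_compactApprox`).
  Intended witnesses: `𝒦 = {R(f_n) | n}` for a Dirac sequence `{f_n}` on `U(W)(𝔸)`.  PUBLISHED THEOREMS, quoted
  verbatim from J. R. Getz, H. Hahn, *An Introduction to Automorphic Representations, with a view toward trace
  formulae*, GTM 300, Springer 2024:  (integrated representation) §3.3, p. 58: "Given a representation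
  `π : G → GL(V)` of `G`, if `f ∈ C_c(G)` one obtains a linear map `π(f) : V → V, φ ↦ ∫_G π(g)f(g)φ d_r g`.  If `π` is
  unitary then this map is bounded";  (symmetry, non-degeneracy) §9.3, p. 179: "A Dirac sequence on `G(𝔸_F)¹` is a
  sequence of nonnegative (real valued) functions `f_n ∈ C_c^∞(G(𝔸_F)¹)` … (b) One has `f_n(x⁻¹) = f_n(x)` … for
  representations `(R, V)` of `G(𝔸_F)¹` and `φ ∈ V` one has `R(f_n)φ → φ` as `n → ∞` (Exercise 9.8).  We also note
  that if `f_n` is a Dirac sequence and `(R, V)` is a unitary representation of `G(𝔸_F)¹` then `R(f_n)` is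
  self-adjoint for every `n` by condition (b)";  (compactness) Theorem 9.1.1 (Gelfand and Piatetski-Shapiro),
  p. 174: "The subspace `L²_cusp([G]) ≤ L²([G])` is closed and `R_cusp(f)` is of trace class for all
  `f ∈ C_c^∞(G(𝔸_F)¹)`" — for `G = Res U(W)`, anisotropic (`W` definite at `ι₁`, PerL l. 384: "`[U(W)]` is compact"),
  there is no proper parabolic subgroup, so `L²_cusp([G]) = L²([G])` and `G(𝔸_F)¹ = G(𝔸_F)`; trace class ⇒ compact;
  (invariance) `R(f) = ∫ f(g)R(g) dg` maps a closed `R(G(𝔸_F))`-invariant subspace into itself (closed subspaces are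
  closed under Bochner integrals).  The kernel proof over this hypothesis is that of ibid. Lemma 9.3.1, p. 179 ("Let
  `(R, V)` be a unitary representation of `G(𝔸_F)¹`.  Assume that there is a Dirac sequence `{f_n}` on `G(𝔸_F)¹` such
  that `R(f_n)` is compact for all `n`.  Then `(R, V)` decomposes into a Hilbert space direct sum of irreducible
  closed `G(𝔸_F)¹`-invariant representations"; "an adaptation of the proof of [Bor97, Lemma 16.1]"). -/
  compactApprox : RepDecomp.HasCompactApprox C.R
  /-- AX1b(a): completeness of the `G_U`-side decomposition (unchanged). -/
  hatτ_complete : (⨆ j, C.hatτ j).topologicalClosure = ⊤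

variable {C}

/-- **`AnalyticK → Analytic`**: the discrete decomposition is DERIVED (`RepDecomp.discreteDecomp_of_compactApprox`). -/
theorem AnalyticK.toAnalytic (h : C.AnalyticK) : C.Analytic where
  R_unitary := h.R_unitary
  discreteDecomp := RepDecomp.discreteDecomp_of_compactApprox h.R_unitary h.compactApprox
  hatτ_complete := h.hatτ_complete

end RepCoreCarrier

namespace Universe

namespace RepThetaCarrier

variable {U : Universe} (D : U.RepThetaCarrier)

/-- The analytic hypotheses with the compactness INPUT per context (core: `AnalyticK`; torus sides unchanged). -/
structure AnalyticK : Prop where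
  core : ∀ {L : CMField} {ι₁ : L →+* ℂ} (V : HermSpace3 L ι₁) (c : SeesawCtx L), (D.core V c).AnalyticK
  t12 : ∀ {L : CMField} {ι₁ : L →+* ℂ} (V : HermSpace3 L ι₁) (c : SeesawCtx L), (D.t12 V c).Analytic
  t34 : ∀ {L : CMField} {ι₁ : L →+* ℂ} (V : HermSpace3 L ι₁) (c : SeesawCtx L), (D.t34 V c).Analytic

variable {D}

/-- (Ported verbatim from the HodgeCMPerL package; no docstring in the source.) -/
theorem AnalyticK.toAnalytic (h : D.AnalyticK) : D.Analytic where
  core := fun V c => (h.core V c).toAnalytic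
  t12 := h.t12
  t34 := h.t34

end RepThetaCarrier

end Universe

namespace Assembly

open HodgeCM.Universe (RepThetaCarrier ThetaModel)

variable (U : Universe)

/-- **Both realisation inputs** over a representation-theoretic carrier whose discreteness is DERIVED from compactness. -/
theorem realisationExists_ofRepCarrierK (M : U.ModelAxioms) (D : U.RepThetaCarrier) (hA : D.AnalyticK)
    (A : (ThetaModel.ofRepCarrier D hA.toAnalytic).Inputs) (hHR : U.Fact_hodgeRiemann20) :
    U.RealisationExistsPerL ∧ U.RealisationExistsFace :=
  realisationExists_ofRepCarrier U M D hA.toAnalytic A hHR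

/-- **COR-CM, END STATE** over such a carrier. -/
theorem COR_CM_endState_ofRepCarrierK (M : U.ModelAxioms) (h29 : U.Fact_weightSpan) (h30 : U.Fact_weightHodge)
    (hE : U.Qw8ExtProd) (hD : U.Qw8DualPushPull) (hMi : U.Qw8Milne) (D : U.RepThetaCarrier) (hA : D.AnalyticK)
    (A : (ThetaModel.ofRepCarrier D hA.toAnalytic).Inputs) (hHR : U.Fact_hodgeRiemann20) : U.HC_CM :=
  COR_CM_endState_ofRepCarrier U M h29 h30 hE hD hMi D hA.toAnalytic A hHR

end Assembly

end HodgeCM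

end
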